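import Summits.BirchSwinnertonDyer.Rank1Residual.O5.FlexNormalFormIsogenous
import HarnessLib

/-!
# O5 — the Case-N Kodaira laws T30.4 / T31-N RE-TYPED over the TRUE 3-adic valuation (v2 nodes; ERRATUM for the fuel-bounded v1)
(cell `b2b-bsdres`, lane CLASS-CLOSURE, class O5; typer of record cc-typer-5 GEN 16; docket cc-lead ⟦gen64⟧ (2′) (c28), wording of
 record = the typer's (R) word HOME/INBOX.md 2026-08-22 l.12419, AGREED by n1011-p18 GEN 13 l.12430, preference (A) of o5-r2 GEN 15
 l.12374, o5-r1 (author of A-O5-28 / A-O5-29) silent ⇒ (R); sibling of `O5/O5FlatKummerNormalForm.lean` (A-O5-28, 399 l.) and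
 `O5/FlexNormalFormIsogenous.lean` (A-O5-29) for `lint.size` — neither parent decl is removed, renamed or re-worded here.)

HONEST FRAMING (cell `b2b-bsdres`, run/shared/lean/b2b/bsd-rank1-residual/, verbatim in every file): the goal of the cell is
to DELETE the COMBINATION-SHAPED residual classes of the Birch–Swinnerton-Dyer formula for ALL analytic-rank `≤ 1` elliptic
curves over `ℚ` — "full BSD formula for every rank `≤ 1` curve in class `C`" assembled STRICTLY from published theorems — so that
the rank-`≤ 1` remainder becomes exactly the CONSTRUCTION-SHAPED classes, which are TYPED (missing-input `Prop`s), NOT attempted.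
This is not "finishing BSD". Lane CLASS-CLOSURE: research routes; census output is EVIDENCE / conjecture items, never a Literature
fact; nothing is booked; no mark of `RESIDUAL-MAP.md` moves; O5 stays OPEN.

ERRATUM (located by n1011-p18 GEN 13, HOME/INBOX.md l.12353 / l.12400; concurred by o5-r2 l.12374 and by the typer l.12419).
The computable predictors `cellN` (T30.4) and `isoN` (T31-N) read `w := ord3 64 (b ^ 3 - A₃)`, and `ord3 64 x = min (v₃ x, 64)` for
`x ≠ 0` (fuel-bounded — the parent docstring's 'any 3-adic approximations to precision 3⁶⁴ give the same answer' is true of the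
FUNCTION, not of a ∀-statement over all integers).  Hence the v1 nodes `FlexNFCaseNKodairaLawThree` (`O5FlatKummerNormalForm.lean`
l.277) and `Isogenous.FlexNFIsogenousCaseNKodairaLawThree` (`FlexNormalFormIsogenous.lean` l.230) are FALSE AS TYPED on the pairs
`(b, A₃)` of the `(1,1)` cell with `v₃(b³ − A₃) = w ≥ 65`: they assert `Istar 61` (resp. `Istar 183`) where the curve is `I*_{w−3}`
(resp. `I*_{3(w−3)}`).  WITNESS: `b = 1`, `A₃ = 1 − 3⁶⁵` (`A₃ % 3 = 1`, `b³ ≠ A₃`): `(cellN 1 (1 - 3^65)).kod = .Istar 61` by `decide`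
(p18, kernel), whereas `nfQ 1 A₃ 0` has `v₃Δ = 68`, `v₃c₄ = 2`, `v₃ j = −62 < 0`, type `I*₆₂`, `f₃ = 2`.  This is a TYPING ARTEFACT
(instrument fuel inside a law), NOT a slip in Tate's algorithm and NOT mathematics lost: every census row (P-K19 kit j142073, P-K20)
has `v₃(b³ − A₃) ≤ 64`, so the censuses support the v2 nodes below exactly as they supported v1.  REPAIR (this file): the predictors
are re-exposed with `w` a PARAMETER (`cellNAt`, `isoNAt`; `cellN` / `isoN` are their values at `ord3 64 (b³ − A₃)` by `rfl`, so every
`decide` example of the parents stands), and the LAWS are re-typed reading the TRUE valuation `padicValInt 3 (b ^ 3 - A₃)`: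
`FlexNFCaseNKodairaValLawThree` (T30.4 v2) and `Isogenous.FlexNFIsogenousCaseNKodairaValLawThree` (T31-N v2).  The v1 nodes STAY in
their files as settled NEGATIVE EDGES (n1011-p18's `FlexNormalForm.not_flexNFCaseNKodairaLawThree` / `Isogenous.not_flexNFIsogenousCaseNKodairaLawThree`,
`O5/FlexNFCaseNTailThree.lean`, p333659 ACCEPTED on the typer's by-name pid ask per n1011 lead R5-128; that file also PROVES the `I*ₙ` tails
`kodairaSymbolAt_and_ord_nfQ_zero_tail` / `kodairaSymbolAt_and_ord_isoQ_zero_tail` = the w ≥ 4 halves of the v2 laws below); their ERRATUM banners and the drop of their `@[conjecture]` attributes are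
DOC / ATTRIBUTE-ONLY touches of the parent files docketed separately (cc-lead ⟦gen64⟧ (2′): attribute dropped only after the refutation
has a pid).  The Kummer-law node `FlexNFCaseNKummerLawThree` and the `c`-free fields are UNAFFECTED (on the `(1,1)` branch `(k, t) =
(0, O)` and `f = 2` for every `w ∉ {2, 3}`, capped or not — p18 l.12430 confirms); the in-parent consumer `typeIII_flatUnit_of_laws`
(hypothesis = the refuted v1 node) is RE-POINTED here as `typeIII_flatUnit_of_valLaws`.

WHAT IS TYPED: `cellNAt` / `isoNAt` (computable; bodies = the parents' `cellN` / `isoN` with `w` a parameter), `cellN_eq_cellNAt` /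
`isoN_eq_isoNAt` (`rfl`), **`@[conjecture] FlexNFCaseNKodairaValLawThree`** and **`@[conjecture] Isogenous.FlexNFIsogenousCaseNKodairaValLawThree`**
(THEOREM-CANDIDATES, EVIDENCE-labelled as their v1 twins; statement text = cc-lead ⟦gen64⟧ (2′) (c28) verbatim; kernel proofs BANKED by
n1011-p18 GEN 13 — `HOME/b2b-bsdres-n1011-p18/g13/f3-drafts/` cells + the `I*ₙ` tail for every `w ≥ 4` via
`exists_kodairaSymbolAt_eq_Istar_succ_of_potMult_three`, `…_of_padicValInt_le`, `ord3_eq_padicValInt` — to be filed as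
`flexNFCaseNKodairaValLawThree_holds` / `flexNFIsogenousCaseNKodairaValLawThree_holds` against THESE names, token for token),
PROVED bookkeeping `cellNAt_k_of_kod_eq_III`, `typeIII_flatUnit_of_valLaws`.  `@[conjecture]` × 2; 0 Literature facts; net named-fact
debt 0; no `sorry`. STATUS ⟦cc-typer-5 GEN 17, rider (r4)⟧: T30.4 v2 PROVED AS TYPED (n1011-p18 GEN 14 `flexNFCaseNKodairaValLawThree_holds`, p338773) — its `@[conjecture]` attribute
dropped, statement bytes unchanged; T31-N v2 stays a THEOREM-CANDIDATE (its `_holds` is banked rc 0 in `HOME/b2b-bsdres-n1011-p18/g14/t5/`, not yet filed); `@[conjecture]` × 1 now. STATUS ⟦cc-typer-5 GEN 18⟧: T31-N v2 PROVED AS TYPED (n1011-p18 GEN 16 `Isogenous.flexNFIsogenousCaseNKodairaValLawThree_holds`, `O5/FlexNFIsogenousCaseNValLawThreeProofs.lean` p344759) — its `@[conjecture]` attribute dropped, statement bytes unchanged; BOTH v2 nodes of this file are THEOREMS; `@[conjecture]` × 0 now.  DEDUP (`lean search`): `cellNAt`, `isoNAt`, `…ValLawThree` — no match.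
References: as the parents — J. H. Silverman, ATAEC IV.9.4 (Tate's algorithm) [SilvermanATAEC1994]; T. Dokchitser, V. Dokchitser,
Acta Arith. (2015) Table 1 [DokchitserDokchitser2015LocalInvariantsIsogenous].
-/

open WeierstrassCurve Literature.NumberTheory.DiophantineGeometry

namespace Summit.BirchSwinnertonDyer.Rank1Residual.O5.FlexNormalForm

/-! ## §1 T30.4 v2 (Case N of the flex normal form `y² + 3b·xy + A₃y = x³`, `A₃ ≡ 1 (mod 3)`) -/

/-- **T30.4's cell predictor with the valuation `w = v₃(b³ − A₃)` a PARAMETER** (body = `cellN`'s, verbatim except that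
`let w := ord3 64 (b ^ 3 - A₃)` is replaced by the argument `w`).  Computable; `cellN b A₃ = cellNAt b A₃ (ord3 64 (b³ − A₃))`
by `rfl` (`cellN_eq_cellNAt`).  Junk outside the hypotheses, as `cellN`. [folklore] -/
def cellNAt (b A₃ : ℤ) (w : ℕ) : Cell :=
  let b3 := b % 3
  let a9 := A₃ % 9
  if b3 ≠ 1 then
    (if (b3 = 0 ∧ a9 = 7) ∨ (b3 = 2 ∧ a9 = 4) then ⟨.III, some 2, 3, oggF .III 3, 1, .U⟩
      else ⟨.II, some 1, 3, oggF .II 3, (if a9 = 1 then 0 else 1), (if a9 = 1 then .O else .U)⟩)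
  else if a9 ≠ 1 then ⟨.II, some 1, 4, oggF .II 4, 1, .U⟩
  else
    let m := (3 * b - 2 - A₃) / 9
    let g := (b ^ 3 - A₃) / 27
    if w = 2 then
      (if m % 3 = 1 then ⟨.IV, some 3, 5, oggF .IV 5, 1, .U⟩ else ⟨.IV, some 1, 5, oggF .IV 5, 0, .O⟩)
    else if w = 3 then ⟨.Istar 0, some (if g % 3 = 1 then 1 else 2), 6, oggF (.Istar 0) 6, 0, .O⟩
    else ⟨.Istar (w - 3), none, w + 3, oggF (.Istar (w - 3)) (w + 3), 0, .O⟩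

/-- The parent's fuel-bounded predictor IS `cellNAt` at `w = ord3 64 (b³ − A₃)` (definitionally). [folklore] -/
theorem cellN_eq_cellNAt (b A₃ : ℤ) : cellN b A₃ = cellNAt b A₃ (ord3 64 (b ^ 3 - A₃)) := rfl

/-- The witness cell of the ERRATUM, on the predictor side: at `w = 65` the capped predictor says `I*₆₁`, the
uncapped one `I*₆₂` (kernel `decide`; the curve-side half of the witness is n1011-p18's). [folklore] -/
example : (cellN 1 (1 - 3 ^ 65)).kod = .Istar 61 ∧ (cellNAt 1 (1 - 3 ^ 65) 65).kod = .Istar 62 := by decide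

section Law

open Summit.BirchSwinnertonDyer.Rank1Residual

/-- **T30.4 v2 `FlexNFCaseNKodairaValLawThree` — THEOREM: PROVED AS TYPED by n1011-p18 GEN 14, `FlexNormalForm.flexNFCaseNKodairaValLawThree_holds`
(`O5/FlexNFCaseNKodairaValLawThreeProofs.lean`, p338773 ACCEPTED; cells `O5/FlexNFCaseNKodairaCellsThree.lean` p336142 + the `I*ₙ` tail p333659; binders verbatim, axioms standard);
`@[conjecture]` DROPPED ⟦cc-typer-5 GEN 17, rider (r4) of cc-lead ⟦gen66⟧ (2′)⟧, statement bytes unchanged; census = EVIDENCE; a `_holds` closes no pair; O5 OPEN.**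
**(As typed: THEOREM-CANDIDATE; supersedes the v1 node `FlexNFCaseNKodairaLawThree`, which is
FALSE AS TYPED for `v₃(b³ − A₃) ≥ 65` under the `ord3 64` fuel — ERRATUM in the module text; proof = T30 §1 by Tate's algorithm on
`nfT` for the cells II / III / IV / I₀* and, for the `I*ₙ` tail `w ≥ 4`, `v₃c₄ = 2 ⇒ minimal + additive`, `v₃ j = 3 − w < 0 ⇒ I*_{w−3}`,
`f₃ = 2` (kernel proofs BANKED by n1011-p18 GEN 13, filed as `flexNFCaseNKodairaValLawThree_holds` against this name); EVIDENCE
P-K19 exactly as for v1 — every census row has `v₃(b³ − A₃) ≤ 64`, where `cellNAt … (padicValInt 3 …) = cellN …`).**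
For `b, A₃ ∈ ℤ` with `A₃ ≡ 1 (mod 3)` and `b³ ≠ A₃` the curve `y² + 3b·xy + A₃y = x³` has at `3` the Kodaira symbol and the
conductor exponent computed by `cellNAt b A₃ (v₃(b³ − A₃))`.  Why it might fail: only by a slip in the Tate run (each branch a finite
residue computation) — the fuel artefact of v1 is removed by construction.  Statement text = cc-lead ⟦gen64⟧ (2′) (c28) verbatim.
[cite: SilvermanATAEC1994, IV.9.4 (Tate's algorithm)] [cite: DokchitserDokchitser2015LocalInvariantsIsogenous, Table 1 (arXiv:1208.5519 p. 3)]
[evidence: census cell O5, o5-r1 GEN 13, P-K19 kit j142073 (pre-registered gen13/P-K19-PREREG.md 29ea23ef8cc75c6f, frozen scorer 21d36208e1c08241): (Kodaira, c₃, v₃Δ, f₃) = cellN = cellNAt at the true valuation on every Case-N row (all rows have v₃(b³ − A₃) ≤ 64), 0 exceptions — T30-FLAT-KUMMER-NORMAL-FORM.md §3; n1011-p18 GEN 13: the as-typed v1 refuted at the witness b = 1, A₃ = 1 − 3⁶⁵ (fuel artefact), kernel proofs of every cell of v2 banked rc 0] -/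
def FlexNFCaseNKodairaValLawThree : Prop :=
  ∀ b A₃ : ℤ, A₃ % 3 = 1 → b ^ 3 ≠ A₃ →
    (nfQ b A₃ 0).kodairaSymbolAt (Additive.placeOf 3) = (cellNAt b A₃ (padicValInt 3 (b ^ 3 - A₃))).kod ∧
      (nfQ b A₃ 0).conductorExponent (Additive.placeOf 3) = (cellNAt b A₃ (padicValInt 3 (b ^ 3 - A₃))).f

end Law

/-- Type III occurs only on the first branch of the predictor, where `(k, t) = (1, U)` — for EVERY value of the parameter `w`
and independently of it (the `(1,1)` branch outputs IV / I₀* / I*ₙ). [folklore] -/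
theorem cellNAt_k_of_kod_eq_III (b A₃ : ℤ) (w w' : ℕ) (h : (cellNAt b A₃ w).kod = .III) :
    (cellNAt b A₃ w').k = 1 ∧ (cellNAt b A₃ w').t = .U := by
  unfold cellNAt at h ⊢
  simp only at h ⊢
  (split_ifs at h ⊢; simp_all)

/-- **T29.6 in normal form from the v2 laws** (re-pointing of the parent's `typeIII_flatUnit_of_laws`, whose hypothesis is the
refuted v1 node): the v2 Kodaira law and the (unaffected) Kummer law of Case N give `FlexNFTypeIIIFlatUnitThree`.  PROVED bookkeeping;
nothing asserted about `hK` / `hU`. [folklore] -/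
theorem typeIII_flatUnit_of_valLaws (hK : FlexNFCaseNKodairaValLawThree) (hU : FlexNFCaseNKummerLawThree) :
    FlexNFTypeIIIFlatUnitThree := by
  intro b A₃ h₁ hΔ hIII
  obtain ⟨hkod, -⟩ := hK b A₃ h₁ hΔ
  obtain ⟨hflat, hunit, -⟩ := hU b A₃ h₁ hΔ
  rw [hkod] at hIII
  have hk : (cellN b A₃).k = 1 := by
    rw [cellN_eq_cellNAt]
    exact (cellNAt_k_of_kod_eq_III b A₃ _ _ hIII).1
  exact ⟨hflat, hunit hk⟩

/-! ## §2 T31-N v2 (the 3-isogenous curve `E′ = E/⟨P₀⟩`, Case N) -/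

namespace Isogenous

/-- **T31-N's E′-cell predictor with the valuation `w = v₃(b³ − A₃)` a PARAMETER** (body = `isoN`'s, verbatim except that
`let w := ord3 64 (b ^ 3 - A₃)` is replaced by the argument `w`).  Computable; `isoN b A₃ = isoNAt b A₃ (ord3 64 (b³ − A₃))` by `rfl`.
[folklore] -/
def isoNAt (b A₃ : ℤ) (w : ℕ) : IsoCell :=
  let b3 := b % 3
  let a9 := A₃ % 9
  if b3 ≠ 1 then
    (if (b3 = 0 ∧ a9 = 7) ∨ (b3 = 2 ∧ a9 = 4) then ⟨.IIIstar, some 2, 9, oggF .IIIstar 9, 1⟩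
      else ⟨.IVstar, some (if a9 = 1 then 3 else 1), 9, oggF .IVstar 9, 1⟩)
  else if a9 ≠ 1 then ⟨.IIstar, some 1, 12, oggF .IIstar 12, 1⟩
  else
    let g := (b ^ 3 - A₃) / 27
    if w = 2 then ⟨.II, some 1, 3, oggF .II 3, 0⟩
    else if w = 3 then ⟨.Istar 0, some (if g % 3 = 1 then 1 else 2), 6, oggF (.Istar 0) 6, 0⟩
    else ⟨.Istar (3 * (w - 3)), none, 3 * (w - 3) + 6, oggF (.Istar (3 * (w - 3))) (3 * (w - 3) + 6), 0⟩

/-- The parent's fuel-bounded predictor IS `isoNAt` at `w = ord3 64 (b³ − A₃)` (definitionally). [folklore] -/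
theorem isoN_eq_isoNAt (b A₃ : ℤ) : isoN b A₃ = isoNAt b A₃ (ord3 64 (b ^ 3 - A₃)) := rfl

/-- The witness cell of the ERRATUM on the E′ side: capped `I*₁₈₃` vs uncapped `I*₁₈₆` at `w = 65`. [folklore] -/
example : (isoN 1 (1 - 3 ^ 65)).kod = .Istar 183 ∧ (isoNAt 1 (1 - 3 ^ 65) 65).kod = .Istar 186 := by decide

section Law

open Summit.BirchSwinnertonDyer.Rank1Residual

/-- **T31 Case N v2 `FlexNFIsogenousCaseNKodairaValLawThree` — THEOREM: PROVED AS TYPED by n1011-p18 GEN 16, `FlexNormalForm.Isogenous.flexNFIsogenousCaseNKodairaValLawThree_holds`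
(`O5/FlexNFIsogenousCaseNValLawThreeProofs.lean`, p344759 ACCEPTED; cells `O5/FlexNFIsogenousCaseNMidCells.lean` p343453 + `O5/FlexNFIsogenousCaseNZeroCells.lean` p343995; Tate's algorithm at `3` on `isoModel` with the `I*` tail for every `w ≥ 4`; binders verbatim, axioms standard);
`@[conjecture]` DROPPED ⟦cc-typer-5 GEN 18 — n1011 lead R5-174 restamp docket / cc-lead ⟦gen71⟧ (2′) riders⟧, statement bytes unchanged; census = EVIDENCE; a `_holds` closes no pair; O5 OPEN.**
**(As typed: THEOREM-CANDIDATE; supersedes the v1 node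
`FlexNFIsogenousCaseNKodairaLawThree`, FALSE AS TYPED for `v₃(b³ − A₃) ≥ 65` under the `ord3 64` fuel — ERRATUM in the module text;
proof = gen14/T31-ISOGENOUS-COLUMN.md §1, Tate's algorithm on `isoModel`, with the `I*_{3(w−3)}` tail for every `w ≥ 4`; kernel route
banked by n1011-p18 GEN 13 (`g13/README.md`), to be filed as `flexNFIsogenousCaseNKodairaValLawThree_holds` against this name;
EVIDENCE P-K20 exactly as for v1 — every census row has `v₃(b³ − A₃) ≤ 64`).**  For `A₃ ≡ 1 (mod 3)`, `b³ ≠ A₃`: the curve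
`isoQ b A₃ 0` (`≅ E/⟨P₀⟩`) has at `3` the Kodaira symbol and conductor exponent computed by `isoNAt b A₃ (v₃(b³ − A₃))`.
Why it might fail: only by a slip in the Tate run.
[cite: SilvermanATAEC1994, IV.9.4] [cite: DokchitserDokchitser2015LocalInvariantsIsogenous, Table 1 (arXiv:1208.5519 p. 3)]
[evidence: census cell O5, o5-r1 GEN 14, P-K20 (pre-registered gen14/P-K20-PREREG.md 907644595fbf3558, frozen scorer d8aabe323106131a): (Kodaira, c₃, a(φ̂)) of E′ and f₃(E′) = f₃(E) = isoN = isoNAt at the true valuation on 343 472 / 343 472 class-01 rows (all with v₃(b³ − A₃) ≤ 64), 0 exceptions; n1011-p18 GEN 13: v1 refuted as typed at b = 1, A₃ = 1 − 3⁶⁵ (isoN ⇒ I*₁₈₃, curve I*₁₈₆), fuel artefact] -/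
def FlexNFIsogenousCaseNKodairaValLawThree : Prop :=
  ∀ b A₃ : ℤ, A₃ % 3 = 1 → b ^ 3 ≠ A₃ →
    (isoQ b A₃ 0).kodairaSymbolAt (Additive.placeOf 3) = (isoNAt b A₃ (padicValInt 3 (b ^ 3 - A₃))).kod ∧
      (isoQ b A₃ 0).conductorExponent (Additive.placeOf 3) = (isoNAt b A₃ (padicValInt 3 (b ^ 3 - A₃))).f

end Law

end Isogenous

end Summit.BirchSwinnertonDyer.Rank1Residual.O5.FlexNormalForm
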